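import Summits.BirchSwinnertonDyer.Rank1Residual.X11b.Three.KolyvaginClassMultiplicativePlace
import Summits.BirchSwinnertonDyer.Rank1Residual.X11b.Three.UnramifiedClassCusp
import HarnessLib

/-!
# X11b at `p = 3` (team N8/O2), S15 (iv) END-FORM ASSEMBLY: Gross 1991 Prop. 6.2 (1) for
# Kolyvagin's point `P_n` at EVERY finite place `v ∤ n` — good (tree), multiplicative (x11b3-p8),
# additive (ONE labelled residual binder)

HONEST FRAMING (cell `b2b-bsdres`, run/shared/lean/b2b/bsd-rank1-residual/, verbatim in every
file): the goal of the cell is to DELETE the COMBINATION-SHAPED residual classes of the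
Birch–Swinnerton-Dyer formula for ALL analytic-rank `≤ 1` elliptic curves over `ℚ` — "full BSD
formula for every rank `≤ 1` curve in class `C`" assembled STRICTLY from published theorems — so
that the rank-`≤ 1` remainder becomes exactly the CONSTRUCTION-SHAPED classes, which are TYPED
(missing-input `Prop`s), NOT attempted. This is not "finishing BSD". Team N8/O2 = `x11b3`, LEAD
DEAL #7 R7-7 / R7-26 (2) / R7-40 / R7-45: S15 (iv) END-FORM ASSEMBLY, first cut (owner x11b3-p2
GEN 3 per R7-45; dealt to x11b3-p1 by R7-7 / R7-26, ownership passed at 09:06Z). LABEL OF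
RECORD: flag-discharge hygiene for `JET@p|N` (harvest E66 (D)) — NOT count-moving; nothing is
booked; `O2` OPEN. THEOREMS ONLY: no definition, no named fact, no `sorry`. The flag `JET@p|N` is
NOT discharged here: the PUBLISHED binder `hGZ31` ([GZ86, III (3.1)] via Gross 1991 p. 245), the
Euler-system data and Jetchev §§5–7 remain.

## What

x11b3-p1's END FORM `GrossBadPlace.kolyvaginClass_kolyvaginPoint_mem_selmerLocalKer_of_GZ31`
(`KolyvaginClassBadPlaceEnd`, p254200) proves Gross 1991 Prop. 6.2 (1) — `c(jP_n) ∈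
selmerLocalKer W K_v p^M` ("`d(n)_v = 0`") — at a finite place `v ∤ n` modulo the component input
(α) `hvanish` ("`H¹(K_v^{un}/K_v, E⁰) = 0` [M; Ch. I, Prop. 3.8]", Gross p. 244) for the
receptacle `B ⊆ E(K̄_v)` of `hGZ31`. The S15 hands supply (α): at GOOD `v` the tree's
`Milne2006_unramifiedClass_eq_zero_holds` (no receptacle condition; x11b3-p1's sanity leaf
`kolyvaginClass_mem_selmerLocalKer_of_inertia_of_hasGoodReductionAt`, p253373); at MULTIPLICATIVE
`v` x11b3-p8's `UnramifiedNode.oneCocycleClass_eq_zero_of_hasMultiplicativeReductionAt` for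
`B ⊆ E⁰(K̄_v)` (consumer corollary `UnramifiedNode.kolyvaginClass_kolyvaginPoint_mem_selmerLocalKer_of_GZ31_of_hasMultiplicativeReductionAt`,
`KolyvaginClassMultiplicativePlace`, p257318). This file ASSEMBLES over the place types
(Silverman *AEC* VII.5.1 trichotomy, tree `hasGoodReductionAt_or_hasMultiplicativeReductionAt_or_hasAdditiveReductionAt`):

* `kolyvaginClass_kolyvaginPoint_mem_selmerLocalKer_of_GZ31_of_isSemistableAt` — **Prop. 6.2 (1)
  for `P_n` at every SEMISTABLE place `v ∤ n`** (good or multiplicative; all places of a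
  semistable `E`, in particular every place of the Heegner field of an X11b curve with square-free
  conductor): NO (α) hypothesis left; inputs = the Euler-system data, McCallum's standing inputs,
  `hI` (inertia at `v` fixes `jP_n`: "`K_n/K` unramified at `v ∤ n`"), and `hGZ31` with its
  receptacle `B ⊆ E⁰(K̄_v)` (`hB`, stated through the tree's witnesses `w`, `ι`, `C` at `v`,
  x11b3-p8's design) — at a good place `hGZ31`'s local clause and `hB` are not used.
* `kolyvaginClass_kolyvaginPoint_mem_selmerLocalKer_of_GZ31_of_additiveResidual` — **the same at
  EVERY finite place `v ∤ n`**, with the additive case carried as ONE LABELLED RESIDUAL BINDER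
  `hadd` ('S15 residual input (C1)-additive': `W.HasAdditiveReductionAt v →` (α) for `B`), to be
  discharged by x11b3-p8's `UnramifiedClassCusp` (LEAD R7-35, "Lang for `𝔾_a`" = Artin–Schreier;
  pending) — after which the binder is dropped in a one-line corollary (the second cut, R7-45).
* `kolyvaginClass_kolyvaginPoint_mem_selmerLocalKer_of_GZ31_allPlaces` (SECOND CUT, appended) — **the
  same at EVERY finite place `v ∤ n` with NO (α) hypothesis of any kind**: the additive binder is
  discharged by x11b3-p8's `UnramifiedNode.oneCocycleClass_eq_zero_of_hasAdditiveReductionAt`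
  (`UnramifiedClassCusp`).

S15 residual inputs of the (iv) END FORM after this file: NONE from the unramified layer at
semistable places; `hadd` at additive places (until p8's cusp file); the layer-currency (C2)
refinement (connected Kummer condition, Jetchev Prop. 4.1) is
`JetchevKummer.localKummerMap_mem_connectedKummerCondition_of_cocycle_of_hasMultiplicativeReduction`
(`MultiplicativePlaceAlpha`, p257338) / `…_of_hasAdditiveReduction` (`AdditivePlaceKummer`) with the
residual binders R1–R8 (+ R7′ at additive places) of x11b3-p4's `S15-INTERFACE.md` §4.

References (locators only; no cited FACT): [cite: GrossLMS1991, Prop. 3.6, §4 (4.1), Prop. 6.2 (1)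
pp. 244–245] [cite: GrossZagier1986, III (3.1)] [cite: McCallumLMS1991, §4 (4)–(5), Lemma 4.1,
Lemma 4.3] [cite: MilneADT2006, Ch. I Prop. 3.8] [cite: SilvermanAEC2009, VII.5 Prop. 5.1];
cell files p253373, p253535, p254200 (x11b3-p1), p255910 / p256222 / p256473 / p256686 / p257318
(x11b3-p8), p257338 (x11b3-p2).

## Design

No definitions; `noncomputable section`; `open scoped Classical NNReal`. Namespace
`Summit.BirchSwinnertonDyer.Rank1Residual.X11b.Three.GrossBadPlace` (x11b3-p1's). Axioms:
`propext`, `Classical.choice`, `Quot.sound`.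
-/

noncomputable section

open scoped Classical NNReal
open scoped AddSubgroup

namespace Summit.BirchSwinnertonDyer.Rank1Residual.X11b.Three.GrossBadPlace

open WeierstrassCurve NumberField IsDedekindDomain Field
  Literature.NumberTheory.EllipticCurves Literature.NumberTheory.EllipticCurves.KolyvaginCocycle
  Literature.NumberTheory.EllipticCurves.KolyvaginEuler Literature.NumberTheory.GaloisRepresentations
  Summit.BirchSwinnertonDyer.Rank1Residual.X11b.Three.KolyvaginRoot
  Summit.BirchSwinnertonDyer.Rank1Residual.X11b.Three.UnramifiedNode

universe u

variable {K : Type u} [Field K] [NumberField K] (W : WeierstrassCurve K) [W.IsElliptic] {n : ℤ}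
variable {hdiv : ∀ P : geomPoints W, ∃ Q : geomPoints W, n • Q = P}
variable {𝒢 : Type*} [CommGroup 𝒢] {A₀ : Type*} [AddCommGroup A₀] [DistribMulAction 𝒢 A₀]

/-- **Gross 1991, Prop. 6.2 (1) for Kolyvagin's point `P_n` at every SEMISTABLE place `v ∤ n` —
no (α) hypothesis.** Setting (the tree's, as in x11b3-p1's `…_of_GZ31`): `𝒢 = Gal(K_n/K)` acting
on `A₀ = E(K_n)`; `σ_ℓ` (`ℓ ∈ L`) generate `G_n = H`, `σ_ℓ^{ℓ+1} = 1`, `n = p^M ∣ ℓ+1`; `f` a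
section of `𝒢 → 𝒢/G_n`; `j : E(K_n) → E(K̄)` additive and equivariant over `π : Γ_K → 𝒢` with
admissible image (Gross Lemma 4.3); `c(jP_n)` McCallum's class; `v` a finite place with GOOD or
MULTIPLICATIVE reduction (`hss : W.IsSemistableAt v`), `𝔐` a prime of `\bar 𝓞_v` above `𝓂_v`
(`h𝔐`) whose inertia group fixes `jP_n` (`hI`); `w`, `ι`, `C` the tree's witnesses at `v`
(spectral valuation, `𝓞_v → 𝒪_w`, variable change to the minimal model). INPUTS CARRIED:
**`hGZ31`** ([GZ86, III (3.1)] via Gross 1991 p. 245, cite-only: a `𝒢`-stable `E′ ∋ y_n` with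
`Tr_ℓ y_n ∈ p^M E′` and `n′ • (jx)_v ∈ B` for `x ∈ E′`, `n′` prime to `p^M`) with its receptacle
**`hB : B ⊆ E⁰(K̄_v)`** (points with nonsingular reduction on the minimal model; "`E′ = E⁰ +
E(ℚ)_tors`", `n′ = #E(ℚ)_tors`). CONCLUSION: `c(jP_n) ∈ selmerLocalKer W K_v p^M`. PROOF: good `v`
— the tree's Milne I.3.8 leaf (`kolyvaginClass_mem_selmerLocalKer_of_inertia_of_hasGoodReductionAt`;
`hGZ31`/`hB` unused); multiplicative `v` — x11b3-p8's
`UnramifiedNode.kolyvaginClass_kolyvaginPoint_mem_selmerLocalKer_of_GZ31_of_hasMultiplicativeReductionAt`.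
The flag `JET@p|N` is NOT discharged. [cite: GrossLMS1991, Prop. 6.2 (1), pp. 244–245]
[cite: GrossZagier1986, III (3.1)] [cite: MilneADT2006, Ch. I Prop. 3.8]
[cite: SilvermanAEC2009, VII.5 Prop. 5.1] -/
theorem kolyvaginClass_kolyvaginPoint_mem_selmerLocalKer_of_GZ31_of_isSemistableAt
    -- the Euler-system data (Gross §3, (4.1))
    {σ : ℕ → 𝒢} {L : Finset ℕ} {H : Subgroup 𝒢} [Fintype (𝒢 ⧸ H)] {f : 𝒢 ⧸ H → 𝒢}
    (hf : ∀ q, (f q : 𝒢 ⧸ H) = q) (hgen : H ≤ Subgroup.closure (σ '' (L : Set ℕ)))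
    (hord : ∀ ℓ ∈ L, σ ℓ ^ (ℓ + 1) = 1) (hdvd : ∀ ℓ ∈ L, n ∣ ((ℓ + 1 : ℕ) : ℤ)) {y : A₀}
    -- `E(K_n) → E(K̄)` over `Γ_K → 𝒢_n`, admissible image (Gross Lemma 4.3)
    (π : absoluteGaloisGroup K →* 𝒢) (j : A₀ →+ geomPoints W)
    (hj : ∀ (g : absoluteGaloisGroup K) (a : A₀), j (π g • a) = g • j a)
    (hA : IsAdmissible (absoluteGaloisGroup K) j.range n)
    (hP : j (kolyvaginPoint σ L f y) ∈ invPoints (absoluteGaloisGroup K) j.range n)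
    -- the place: SEMISTABLE, a prime `𝔐` above it, inertia fixes `jP_n`
    (v : HeightOneSpectrum (𝓞 K)) (hss : W.IsSemistableAt v)
    {𝔐 : Ideal (v.localAbsIntegers)} (h𝔐 : 𝔐 ∈ v.localPrimesAbove)
    (hI : ∀ τ ∈ 𝔐.inertia (absoluteGaloisGroup (v.adicCompletion K)),
      resGal (K := K) (v.adicCompletion K) τ • j (kolyvaginPoint σ L f y) =
        j (kolyvaginPoint σ L f y))
    -- the tree's witnesses at `v` and the receptacle `B ⊆ E⁰`
    {w : Valuation (AlgebraicClosure (v.adicCompletion K)) ℝ≥0}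
    (hw : ∀ x, (w x : ℝ) =
      spectralNorm (v.adicCompletion K) (AlgebraicClosure (v.adicCompletion K)) x)
    {ι : v.adicCompletionIntegers K →+* w.integer}
    (hι : ∀ a, ((ι a : w.integer) : AlgebraicClosure (v.adicCompletion K)) =
      algebraMap (v.adicCompletion K) (AlgebraicClosure (v.adicCompletion K))
        (a : v.adicCompletion K))
    {C : VariableChange (v.adicCompletion K)}
    (hC : C • W.baseChange (v.adicCompletion K) =
      (W.localMinimalIntegralModel v).map
        (algebraMap (v.adicCompletionIntegers K) (v.adicCompletion K)))
    {E' : AddSubgroup A₀} (B : AddSubgroup (localPoints W (v.adicCompletion K))) {n' : ℤ}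
    (hB : ∀ Q ∈ B, ((W.localMinimalIntegralModel v).map ι).HasNonsingularReduction
      (Affine.Point.congrEquiv (baseChange_map_eq_baseChange_map hι (W.localMinimalIntegralModel v))
        (Affine.Point.congrEquiv (congrArg (fun X : WeierstrassCurve (v.adicCompletion K) ↦
            X.baseChange (AlgebraicClosure (v.adicCompletion K))) hC)
          (VariableChange.pointEquivBaseChange (W.baseChange (v.adicCompletion K)) C
            (AlgebraicClosure (v.adicCompletion K))
            (Affine.Point.congrEquiv (baseChange_baseChange_adicCompletion W v).symm Q)))))
    -- hGZ31 (= [GZ86, III (3.1)] via Gross 1991 p. 245; cite-only)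
    (hGZ31 : (∀ (γ : 𝒢), ∀ e ∈ E', γ • e ∈ E') ∧ y ∈ E' ∧
      (∀ ℓ ∈ L, grAct A₀ (traceElt (σ ℓ) ℓ) y ∈ E'.map (zsmulAddGroupHom n : A₀ →+ A₀)) ∧
      ∀ x ∈ E', n' • pointsMap W (v.adicCompletion K) (j x) ∈ B)
    (hcop : IsCoprime n n') :
    kolyvaginClass W n hdiv hA (j (kolyvaginPoint σ L f y)) hP ∈
      selmerLocalKer W (v.adicCompletion K) n := by
  rcases hss with hgood | hmult
  · exact kolyvaginClass_mem_selmerLocalKer_of_inertia_of_hasGoodReductionAt W hA hP v hgood h𝔐 hI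
  · exact kolyvaginClass_kolyvaginPoint_mem_selmerLocalKer_of_GZ31_of_hasMultiplicativeReductionAt W
      hf hgen hord hdvd π j hj hA hP v hmult h𝔐 hI hw hι hC B hB hGZ31 hcop

/-- **Gross 1991, Prop. 6.2 (1) for `P_n` at EVERY finite place `v ∤ n`, the additive case
carried as ONE labelled residual binder.** As
`kolyvaginClass_kolyvaginPoint_mem_selmerLocalKer_of_GZ31_of_isSemistableAt`, with the place of
arbitrary reduction type (Silverman *AEC* VII.5.1 trichotomy) and the extra hypothesis **`hadd`**
= 'S15 residual input (C1)-additive': IF `v` is ADDITIVE then every `B`-valued continuous crossed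
homomorphism `Γ_{K_v} → E(K̄_v)` vanishing on the inertia group has trivial class (Milne *ADT*
I.3.8 for `E⁰` at a cusp: "Lang for `𝔾_a`" = Artin–Schreier over `k̄_v`; x11b3-p8's
`UnramifiedClassCusp`, LEAD R7-35 — pending; when it lands this binder is discharged for
`B ⊆ E⁰(K̄_v)` exactly as at multiplicative places). Nothing else is assumed; at a semistable `v`
the binder is vacuous. The flag `JET@p|N` is NOT discharged. [cite: GrossLMS1991, Prop. 6.2 (1),
pp. 244–245] [cite: MilneADT2006, Ch. I Prop. 3.8] [cite: SilvermanAEC2009, VII.5 Prop. 5.1] -/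
theorem kolyvaginClass_kolyvaginPoint_mem_selmerLocalKer_of_GZ31_of_additiveResidual
    {σ : ℕ → 𝒢} {L : Finset ℕ} {H : Subgroup 𝒢} [Fintype (𝒢 ⧸ H)] {f : 𝒢 ⧸ H → 𝒢}
    (hf : ∀ q, (f q : 𝒢 ⧸ H) = q) (hgen : H ≤ Subgroup.closure (σ '' (L : Set ℕ)))
    (hord : ∀ ℓ ∈ L, σ ℓ ^ (ℓ + 1) = 1) (hdvd : ∀ ℓ ∈ L, n ∣ ((ℓ + 1 : ℕ) : ℤ)) {y : A₀}
    (π : absoluteGaloisGroup K →* 𝒢) (j : A₀ →+ geomPoints W)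
    (hj : ∀ (g : absoluteGaloisGroup K) (a : A₀), j (π g • a) = g • j a)
    (hA : IsAdmissible (absoluteGaloisGroup K) j.range n)
    (hP : j (kolyvaginPoint σ L f y) ∈ invPoints (absoluteGaloisGroup K) j.range n)
    (v : HeightOneSpectrum (𝓞 K))
    {𝔐 : Ideal (v.localAbsIntegers)} (h𝔐 : 𝔐 ∈ v.localPrimesAbove)
    (hI : ∀ τ ∈ 𝔐.inertia (absoluteGaloisGroup (v.adicCompletion K)),
      resGal (K := K) (v.adicCompletion K) τ • j (kolyvaginPoint σ L f y) =
        j (kolyvaginPoint σ L f y))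
    {w : Valuation (AlgebraicClosure (v.adicCompletion K)) ℝ≥0}
    (hw : ∀ x, (w x : ℝ) =
      spectralNorm (v.adicCompletion K) (AlgebraicClosure (v.adicCompletion K)) x)
    {ι : v.adicCompletionIntegers K →+* w.integer}
    (hι : ∀ a, ((ι a : w.integer) : AlgebraicClosure (v.adicCompletion K)) =
      algebraMap (v.adicCompletion K) (AlgebraicClosure (v.adicCompletion K))
        (a : v.adicCompletion K))
    {C : VariableChange (v.adicCompletion K)}
    (hC : C • W.baseChange (v.adicCompletion K) =
      (W.localMinimalIntegralModel v).map
        (algebraMap (v.adicCompletionIntegers K) (v.adicCompletion K)))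
    {E' : AddSubgroup A₀} (B : AddSubgroup (localPoints W (v.adicCompletion K))) {n' : ℤ}
    (hB : ∀ Q ∈ B, ((W.localMinimalIntegralModel v).map ι).HasNonsingularReduction
      (Affine.Point.congrEquiv (baseChange_map_eq_baseChange_map hι (W.localMinimalIntegralModel v))
        (Affine.Point.congrEquiv (congrArg (fun X : WeierstrassCurve (v.adicCompletion K) ↦
            X.baseChange (AlgebraicClosure (v.adicCompletion K))) hC)
          (VariableChange.pointEquivBaseChange (W.baseChange (v.adicCompletion K)) C
            (AlgebraicClosure (v.adicCompletion K))
            (Affine.Point.congrEquiv (baseChange_baseChange_adicCompletion W v).symm Q)))))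
    (hGZ31 : (∀ (γ : 𝒢), ∀ e ∈ E', γ • e ∈ E') ∧ y ∈ E' ∧
      (∀ ℓ ∈ L, grAct A₀ (traceElt (σ ℓ) ℓ) y ∈ E'.map (zsmulAddGroupHom n : A₀ →+ A₀)) ∧
      ∀ x ∈ E', n' • pointsMap W (v.adicCompletion K) (j x) ∈ B)
    (hcop : IsCoprime n n')
    -- S15 residual input (C1)-additive (labelled; x11b3-p8's `UnramifiedClassCusp` discharges it)
    (hadd : W.HasAdditiveReductionAt v →
      ∀ c : contOneCocycles (discreteTopRep (absoluteGaloisGroup (v.adicCompletion K))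
        (localPoints W (v.adicCompletion K))),
      (∀ τ, c.1 τ ∈ B) → (∀ τ ∈ 𝔐.inertia (absoluteGaloisGroup (v.adicCompletion K)), c.1 τ = 0) →
        oneCocycleClass _ c = 0) :
    kolyvaginClass W n hdiv hA (j (kolyvaginPoint σ L f y)) hP ∈
      selmerLocalKer W (v.adicCompletion K) n := by
  rcases hasGoodReductionAt_or_hasMultiplicativeReductionAt_or_hasAdditiveReductionAt v W with
    hgood | hmult | ha
  · exact kolyvaginClass_mem_selmerLocalKer_of_inertia_of_hasGoodReductionAt W hA hP v hgood h𝔐 hI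
  · exact kolyvaginClass_kolyvaginPoint_mem_selmerLocalKer_of_GZ31_of_hasMultiplicativeReductionAt W
      hf hgen hord hdvd π j hj hA hP v hmult h𝔐 hI hw hι hC B hB hGZ31 hcop
  · exact kolyvaginClass_kolyvaginPoint_mem_selmerLocalKer_of_GZ31 W hf hgen hord hdvd π j hj hA hP
      v hI B hGZ31 hcop (hadd ha)

/-! ### Second cut (LEAD R7-45): the additive binder discharged — Prop. 6.2 (1) at EVERY finite place -/

/-- **Gross 1991, Prop. 6.2 (1) for Kolyvagin's point `P_n` at EVERY finite place `v ∤ n` — NO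
(α) hypothesis of any kind.** As `…_of_GZ31_of_additiveResidual` with the labelled additive binder
`hadd` DISCHARGED by x11b3-p8's cusp theorem
`UnramifiedNode.oneCocycleClass_eq_zero_of_hasAdditiveReductionAt` (`UnramifiedClassCusp`, p259017:
Milne *ADT* I.3.8 for `E⁰` at a cusp, "Lang for `𝔾_a`" = Artin–Schreier over `k̄_v`; its own
END-FORM corollary there is `…kolyvaginClass_kolyvaginPoint_mem_selmerLocalKer_of_GZ31_of_hasAdditiveReductionAt`). By the tree trichotomy (Silverman *AEC* VII.5.1): good `v` → the Milne leaf (p253373),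
multiplicative `v` → x11b3-p8's node corollary (p257318), additive `v` → x11b3-p8's cusp corollary.
Inputs: the Euler-system data, McCallum's standing inputs, `hI`, the tree witnesses `w`/`ι`/`C`
at `v`, and `hGZ31` with its receptacle `hB : B ⊆ E⁰(K̄_v)` ([GZ86, III (3.1)] via Gross 1991
p. 245; published, cite-only). The flag `JET@p|N` is NOT discharged (Jetchev §§5–7 remain).
[cite: GrossLMS1991, Prop. 6.2 (1), pp. 244–245] [cite: GrossZagier1986, III (3.1)]
[cite: MilneADT2006, Ch. I Prop. 3.8] [cite: SilvermanAEC2009, VII.5 Prop. 5.1] -/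
theorem kolyvaginClass_kolyvaginPoint_mem_selmerLocalKer_of_GZ31_allPlaces
    {σ : ℕ → 𝒢} {L : Finset ℕ} {H : Subgroup 𝒢} [Fintype (𝒢 ⧸ H)] {f : 𝒢 ⧸ H → 𝒢}
    (hf : ∀ q, (f q : 𝒢 ⧸ H) = q) (hgen : H ≤ Subgroup.closure (σ '' (L : Set ℕ)))
    (hord : ∀ ℓ ∈ L, σ ℓ ^ (ℓ + 1) = 1) (hdvd : ∀ ℓ ∈ L, n ∣ ((ℓ + 1 : ℕ) : ℤ)) {y : A₀}
    (π : absoluteGaloisGroup K →* 𝒢) (j : A₀ →+ geomPoints W)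
    (hj : ∀ (g : absoluteGaloisGroup K) (a : A₀), j (π g • a) = g • j a)
    (hA : IsAdmissible (absoluteGaloisGroup K) j.range n)
    (hP : j (kolyvaginPoint σ L f y) ∈ invPoints (absoluteGaloisGroup K) j.range n)
    (v : HeightOneSpectrum (𝓞 K))
    {𝔐 : Ideal (v.localAbsIntegers)} (h𝔐 : 𝔐 ∈ v.localPrimesAbove)
    (hI : ∀ τ ∈ 𝔐.inertia (absoluteGaloisGroup (v.adicCompletion K)),
      resGal (K := K) (v.adicCompletion K) τ • j (kolyvaginPoint σ L f y) =
        j (kolyvaginPoint σ L f y))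
    {w : Valuation (AlgebraicClosure (v.adicCompletion K)) ℝ≥0}
    (hw : ∀ x, (w x : ℝ) =
      spectralNorm (v.adicCompletion K) (AlgebraicClosure (v.adicCompletion K)) x)
    {ι : v.adicCompletionIntegers K →+* w.integer}
    (hι : ∀ a, ((ι a : w.integer) : AlgebraicClosure (v.adicCompletion K)) =
      algebraMap (v.adicCompletion K) (AlgebraicClosure (v.adicCompletion K))
        (a : v.adicCompletion K))
    {C : VariableChange (v.adicCompletion K)}
    (hC : C • W.baseChange (v.adicCompletion K) =
      (W.localMinimalIntegralModel v).map
        (algebraMap (v.adicCompletionIntegers K) (v.adicCompletion K)))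
    {E' : AddSubgroup A₀} (B : AddSubgroup (localPoints W (v.adicCompletion K))) {n' : ℤ}
    (hB : ∀ Q ∈ B, ((W.localMinimalIntegralModel v).map ι).HasNonsingularReduction
      (Affine.Point.congrEquiv (baseChange_map_eq_baseChange_map hι (W.localMinimalIntegralModel v))
        (Affine.Point.congrEquiv (congrArg (fun X : WeierstrassCurve (v.adicCompletion K) ↦
            X.baseChange (AlgebraicClosure (v.adicCompletion K))) hC)
          (VariableChange.pointEquivBaseChange (W.baseChange (v.adicCompletion K)) C
            (AlgebraicClosure (v.adicCompletion K))
            (Affine.Point.congrEquiv (baseChange_baseChange_adicCompletion W v).symm Q)))))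
    (hGZ31 : (∀ (γ : 𝒢), ∀ e ∈ E', γ • e ∈ E') ∧ y ∈ E' ∧
      (∀ ℓ ∈ L, grAct A₀ (traceElt (σ ℓ) ℓ) y ∈ E'.map (zsmulAddGroupHom n : A₀ →+ A₀)) ∧
      ∀ x ∈ E', n' • pointsMap W (v.adicCompletion K) (j x) ∈ B)
    (hcop : IsCoprime n n') :
    kolyvaginClass W n hdiv hA (j (kolyvaginPoint σ L f y)) hP ∈
      selmerLocalKer W (v.adicCompletion K) n :=
  kolyvaginClass_kolyvaginPoint_mem_selmerLocalKer_of_GZ31_of_additiveResidual W hf hgen hord hdvd π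
    j hj hA hP v h𝔐 hI hw hι hC B hB hGZ31 hcop fun ha ↦ fun c hcB hcI ↦
      UnramifiedNode.oneCocycleClass_eq_zero_of_hasAdditiveReductionAt W hw ha h𝔐 hι hC B hB c hcB hcI

end Summit.BirchSwinnertonDyer.Rank1Residual.X11b.Three.GrossBadPlace

end
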